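import Literature.MathematicalPhysics.QuantumFieldTheory.Balaban1983to89.T3PrintedRegularOrbits
import Literature.MathematicalPhysics.QuantumFieldTheory.Balaban1983to89.T3OrbitAverage
import Literature.MathematicalPhysics.QuantumFieldTheory.Balaban1983to89.B12RTGaugeInvariance254
import HarnessLib

/-!
# (RG-K) The residual gauge transformations of the `(K−J)`-fold averaging fibration — letters

Crux of record `stmt-QuantumFields-20520` (`Theses.UnitScaleTilt.FluctuationComparisonRegPrIntL`), LINE g18-1
`Cruxes/FluctuationComparisonRegPrIntL/Lines/semiclassical_s2beta.lean` v6 (ideator ym-r3-idea-1 g18, LINE OWNER WORDS 6–8), row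
LAPLACE = CHART∞ ∘ LIMIT ∘ KNIT ∘ DECAY.  LIMIT instantiates
`Literature.Analysis.Asymptotics.LaplaceMethodOrbitCompact.tendsto_laplaceMethod_orbit_indicator_of_continuous` with the GROUP
`K :=` v6's `ResidualGauge F hJK = {w | ∀ U, D_{J,K}(U^w) = D_{J,K}(U)}` acting on the fine fields by gauge transformations.  This is the
first of three helper files (this one and `…ResidualGaugeOrbit` are definition-free; `…ResidualSubgroup` packages the set as a
`Subgroup` with the instances LIMIT's `K` needs).  Throughout, «`w` is residual» is the v6 predicate written out:
`∀ U, descendTo F ℰp J K hJK (GaugeField.gaugeAct w U) = descendTo F ℰp J K hJK U`, over the carrier `Site (F.P K) 0 → SU(2)`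
(definitionally `GaugeTransf (F.P K) 0 SU(2)`; the `Π`-type spelling is the one Lean's instance search sees).

* §1 letters on the action `U ↦ U^w` (unit, product, inverses, central constants).
* §2 the residual predicate is closed under `1, *, ⁻¹` (print: «These transformations form a group»); the descended reading
  (lit ✓`T3PrintedRegularOrbits.descendTo_gaugeAct` «`D(U^u) = (DU)^{u↓}`»): `w` is residual iff `w↓` stabilises every descended
  field; print's sheet `w↓ ≡ 1` ([Balaban1985Variational] (4) p.278, [Balaban1987RG1] p.256 «u = 1 on T⁽ᵏ⁾», d-generic twin lit
  ✓`B12GaugeOrbits021.residualGroup`) and every central-constant sheet `w↓ ≡ c` are residual.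
* §3 topology: the residual set is CLOSED in the compact group `SU(2)^{sites}`, hence compact (`isCompact_residualGauge`,
  `compactSpace_residualGauge` — the `[CompactSpace K]` of LIMIT).
* §4 the invariant rows: residual transformations preserve every fibre and print's regular fibre (6); every gauge transformation
  preserves the UV-small-history events `histGood` and the Wilson action; hence v6's `argminHist V` (written out) is a UNION OF
  RESIDUAL ORBITS (`hfinv`/`hφinv` of LIMIT for `f := wilsonAction4`).

HONEST: subgroup algebra and point-set topology over landed letters; this file proves NO stub of the line — EXW, GAP♯, LAPLACE
(CHART∞ ∕ LIMIT ∕ KNIT ∕ DECAY), H4ᶜ, LFR♯ᶜ, S2β and crux 20520 stay OPEN; rung R3 (YM₃ on T³) is NOT d = 4, NOT infinite volume, NOT a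
mass gap, NOT Clay; the Yang–Mills mass gap is NOT proved.
-/

noncomputable section

open MeasureTheory Filter Topology Set
open Literature.MathematicalPhysics.QuantumFieldTheory.Balaban1983to89
open Literature.MathematicalPhysics.QuantumFieldTheory.Balaban1983to89.T3ContinuumYM3Torus
open Literature.MathematicalPhysics.QuantumFieldTheory.Balaban1983to89.T3UnitLawDensityEML
open Literature.MathematicalPhysics.QuantumFieldTheory.Balaban1983to89.T3UnitScaleTilt
open Literature.MathematicalPhysics.QuantumFieldTheory.Balaban1983to89.T3TiltDescent
open Literature.MathematicalPhysics.QuantumFieldTheory.Balaban1983to89.T3PrintedRegularMinimiser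
open Literature.MathematicalPhysics.QuantumFieldTheory.Balaban1983to89.T3ConstrainedMinimiser (fibre)
open Literature.MathematicalPhysics.QuantumFieldTheory.Balaban1983to89.T3PrintedRegularOrbits
open Literature.MathematicalPhysics.QuantumFieldTheory.Balaban1983to89.T3LevelShift
open Literature.MathematicalPhysics.QuantumFieldTheory.Balaban1983to89.Missing
open Literature.MathematicalPhysics.QuantumFieldTheory.Balaban1983to89.T4Continuum
open scoped Literature.MathematicalPhysics.QuantumFieldTheory.Balaban1983to89.T3OrbitAverage

namespace Summit.QuantumFields.YangMills.Theorems.FluctuationComparisonRegPrIntLS2BetaResidualGauge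

/-! ## §1 Letters on the action `U ↦ U^w` -/

section Letters

variable {P : Params} {j : ℕ} {G : Type*} [GaugeGroup G]

/-- Gauge transformations compose: `U^{uv} = (U^{v})^{u}` (pointwise product of `Site → G`). [cite: Balaban1985Averaging, (8) p.19] -/
theorem gaugeAct_mul_eq (u v : Site P j → G) (U : GaugeField P j G) :
    GaugeField.gaugeAct (u * v) U = GaugeField.gaugeAct u (GaugeField.gaugeAct v U) := by
  funext b; simp only [GaugeField.gaugeAct, Pi.mul_apply, mul_inv_rev, mul_assoc]

/-- `U^{u}` then `U^{u⁻¹}` is the identity. [cite: Balaban1985Averaging, (8) p.19] -/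
theorem gaugeAct_inv_gaugeAct (u : Site P j → G) (U : GaugeField P j G) :
    GaugeField.gaugeAct (u⁻¹ : Site P j → G) (GaugeField.gaugeAct u U) = U := by
  rw [← gaugeAct_mul_eq, inv_mul_cancel]
  exact B12RTGaugeInvariance254.gaugeAct_one' U

/-- `U^{u⁻¹}` then `U^{u}` is the identity. [cite: Balaban1985Averaging, (8) p.19] -/
theorem gaugeAct_gaugeAct_inv (u : Site P j → G) (U : GaugeField P j G) :
    GaugeField.gaugeAct u (GaugeField.gaugeAct (u⁻¹ : Site P j → G) U) = U := by
  rw [← gaugeAct_mul_eq, mul_inv_cancel]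
  exact B12RTGaugeInvariance254.gaugeAct_one' U

/-- A constant CENTRAL gauge transformation acts trivially on every field. [cite: Balaban1985Averaging, (8) p.19] -/
theorem gaugeAct_const_of_comm {c : G} (hc : ∀ g : G, c * g = g * c) (V : GaugeField P j G) :
    GaugeField.gaugeAct (fun _ => c) V = V := by
  funext b
  simp only [GaugeField.gaugeAct]
  rw [hc, mul_inv_cancel_right]

end Letters

/-! ## §2 The residual predicate: a group; the descended reading; print's sheet `w↓ ≡ 1` -/

section Residual

variable (F : T3Family) {J K : ℕ} (hJK : J ≤ K)

/-- `w ≡ 1` is residual (v6 `one_mem_residualGauge`). [cite: Balaban1985Averaging, (8) p.19] -/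
theorem residual_one :
    ∀ U : GaugeField (F.P K) 0 (Matrix.specialUnitaryGroup (Fin 2) ℂ),
      descendTo F ℰp J K hJK (GaugeField.gaugeAct (1 : Site (F.P K) 0 → Matrix.specialUnitaryGroup (Fin 2) ℂ) U) =
        descendTo F ℰp J K hJK U :=
  fun U => congrArg _ (B12RTGaugeInvariance254.gaugeAct_one' U)

/-- Residual transformations are closed under products («These transformations form a group»).
[cite: Balaban1987RG1, p.256 (three sentences after (0.21))] -/
theorem residual_mul {u v : Site (F.P K) 0 → Matrix.specialUnitaryGroup (Fin 2) ℂ}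
    (hu : ∀ U : GaugeField (F.P K) 0 (Matrix.specialUnitaryGroup (Fin 2) ℂ),
      descendTo F ℰp J K hJK (GaugeField.gaugeAct u U) = descendTo F ℰp J K hJK U)
    (hv : ∀ U : GaugeField (F.P K) 0 (Matrix.specialUnitaryGroup (Fin 2) ℂ),
      descendTo F ℰp J K hJK (GaugeField.gaugeAct v U) = descendTo F ℰp J K hJK U) :
    ∀ U : GaugeField (F.P K) 0 (Matrix.specialUnitaryGroup (Fin 2) ℂ),
      descendTo F ℰp J K hJK (GaugeField.gaugeAct (u * v) U) = descendTo F ℰp J K hJK U := by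
  intro U
  rw [gaugeAct_mul_eq, hu, hv]

/-- Residual transformations are closed under inverses («These transformations form a group»).
[cite: Balaban1987RG1, p.256 (three sentences after (0.21))] -/
theorem residual_inv {u : Site (F.P K) 0 → Matrix.specialUnitaryGroup (Fin 2) ℂ}
    (hu : ∀ U : GaugeField (F.P K) 0 (Matrix.specialUnitaryGroup (Fin 2) ℂ),
      descendTo F ℰp J K hJK (GaugeField.gaugeAct u U) = descendTo F ℰp J K hJK U) :
    ∀ U : GaugeField (F.P K) 0 (Matrix.specialUnitaryGroup (Fin 2) ℂ),
      descendTo F ℰp J K hJK (GaugeField.gaugeAct (u⁻¹ : Site (F.P K) 0 → Matrix.specialUnitaryGroup (Fin 2) ℂ) U) =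
        descendTo F ℰp J K hJK U := by
  intro U
  have h := hu (GaugeField.gaugeAct (u⁻¹ : Site (F.P K) 0 → Matrix.specialUnitaryGroup (Fin 2) ℂ) U)
  rw [gaugeAct_gaugeAct_inv] at h
  exact h.symm

/-- **`w` IS RESIDUAL IFF ITS RESTRICTION `w↓` TO THE COMPARISON LATTICE STABILISES EVERY DESCENDED FIELD** (covariance of the
descent, `D(U^w) = (DU)^{w↓}`). [cite: Balaban1985Averaging, (11)-(13) p.19] -/
theorem residual_iff_descTransf {w : Site (F.P K) 0 → Matrix.specialUnitaryGroup (Fin 2) ℂ} :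
    (∀ U : GaugeField (F.P K) 0 (Matrix.specialUnitaryGroup (Fin 2) ℂ),
        descendTo F ℰp J K hJK (GaugeField.gaugeAct w U) = descendTo F ℰp J K hJK U) ↔
      ∀ U : GaugeField (F.P K) 0 (Matrix.specialUnitaryGroup (Fin 2) ℂ),
        GaugeField.gaugeAct (descTransf F J K hJK w) (descendTo F ℰp J K hJK U) = descendTo F ℰp J K hJK U := by
  refine forall_congr' fun U => ?_
  rw [descendTo_gaugeAct]

/-- **EVERY CENTRAL-CONSTANT SHEET IS RESIDUAL**: if `w↓ ≡ c` with `c` central (on `SU(2)`: `c = ±1`), then `w` is residual —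
the `w̄ ≡ ±1` description of v6's docstring, sufficient direction. [cite: Balaban1985Variational, (4) p.278] -/
theorem residual_of_descTransf_eq_const {w : Site (F.P K) 0 → Matrix.specialUnitaryGroup (Fin 2) ℂ}
    {c : Matrix.specialUnitaryGroup (Fin 2) ℂ} (hc : ∀ g : Matrix.specialUnitaryGroup (Fin 2) ℂ, c * g = g * c)
    (hw : descTransf F J K hJK w = fun _ => c) :
    ∀ U : GaugeField (F.P K) 0 (Matrix.specialUnitaryGroup (Fin 2) ℂ),
      descendTo F ℰp J K hJK (GaugeField.gaugeAct w U) = descendTo F ℰp J K hJK U := by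
  rw [residual_iff_descTransf]
  intro U
  rw [hw]
  exact gaugeAct_const_of_comm hc _

/-- **PRINT'S SHEET `w↓ ≡ 1` IS RESIDUAL** («u = 1 on T⁽ᵏ⁾»; the d-generic `B12GaugeOrbits021.residualGroup` read at the T³ descent).
[cite: Balaban1987RG1, p.256 (three sentences after (0.21)); Balaban1985Variational, (4) p.278] -/
theorem residual_of_descTransf_eq_one {w : Site (F.P K) 0 → Matrix.specialUnitaryGroup (Fin 2) ℂ}
    (hw : descTransf F J K hJK w = fun _ => 1) :
    ∀ U : GaugeField (F.P K) 0 (Matrix.specialUnitaryGroup (Fin 2) ℂ),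
      descendTo F ℰp J K hJK (GaugeField.gaugeAct w U) = descendTo F ℰp J K hJK U :=
  residual_of_descTransf_eq_const F hJK (fun g => by rw [one_mul, mul_one]) hw

end Residual

/-! ## §3 Topology: the residual set is closed, hence compact -/

section Topology

variable (F : T3Family) {J K : ℕ} (hJK : J ≤ K)

/-- The restriction up the block centres `u ↦ u^{(k)}` is continuous (a coordinate projection). [cite: Balaban1985Averaging, (12) p.19] -/
theorem continuous_transfUp {P : Params} {G : Type*} [TopologicalSpace G] (k : ℕ) :
    Continuous fun (u : Site P 0 → G) (y : Site P k) => transfUp u k y := by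
  induction k with
  | zero => exact continuous_id
  | succ k ih =>
    refine continuous_pi fun y => ?_
    exact (continuous_apply (emb y)).comp ih

/-- The restriction `w ↦ w↓` to the comparison lattice is continuous. [cite: Balaban1985Averaging, (12)-(13) p.19] -/
theorem continuous_descTransf :
    Continuous fun (w : Site (F.P K) 0 → Matrix.specialUnitaryGroup (Fin 2) ℂ) (x : Site (F.P J) 0) =>
      descTransf F J K hJK w x := by
  refine continuous_pi fun x => ?_
  exact (continuous_apply _).comp (continuous_transfUp (K - J))

/-- For a fixed fine field, `w ↦ D_{J,K}(U^w)` is continuous (`= (DU)^{w↓}`, continuous in `w↓`). [cite: Balaban1985Averaging, (11) p.19] -/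
theorem continuous_descendTo_gaugeAct (U : GaugeField (F.P K) 0 (Matrix.specialUnitaryGroup (Fin 2) ℂ)) :
    Continuous fun w : Site (F.P K) 0 → Matrix.specialUnitaryGroup (Fin 2) ℂ =>
      descendTo F ℰp J K hJK (GaugeField.gaugeAct w U) := by
  simp_rw [descendTo_gaugeAct]
  exact (T3OrbitAverage.continuous_gaugeAct_left _).comp (continuous_descTransf F hJK)

/-- **THE RESIDUAL SET IS CLOSED** in `SU(2)^{sites}` (an intersection over `U` of equalisers of continuous maps into a Hausdorff
space). [cite: Balaban1987RG1, p.256 (three sentences after (0.21))] -/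
theorem isClosed_residualGauge :
    IsClosed {w : Site (F.P K) 0 → Matrix.specialUnitaryGroup (Fin 2) ℂ |
      ∀ U : GaugeField (F.P K) 0 (Matrix.specialUnitaryGroup (Fin 2) ℂ),
        descendTo F ℰp J K hJK (GaugeField.gaugeAct w U) = descendTo F ℰp J K hJK U} := by
  rw [Set.setOf_forall]
  exact isClosed_iInter fun U => isClosed_eq (continuous_descendTo_gaugeAct F hJK U) continuous_const

/-- **THE RESIDUAL SET IS COMPACT** (closed in the compact group `SU(2)^{sites}`). [cite: Balaban1987RG1, p.256 (three sentences after (0.21))] -/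
theorem isCompact_residualGauge :
    IsCompact {w : Site (F.P K) 0 → Matrix.specialUnitaryGroup (Fin 2) ℂ |
      ∀ U : GaugeField (F.P K) 0 (Matrix.specialUnitaryGroup (Fin 2) ℂ),
        descendTo F ℰp J K hJK (GaugeField.gaugeAct w U) = descendTo F ℰp J K hJK U} :=
  (isClosed_residualGauge F hJK).isCompact

/-- The residual set as a type is a compact space (use as `haveI`). [cite: Balaban1987RG1, p.256 (three sentences after (0.21))] -/
theorem compactSpace_residualGauge :
    CompactSpace {w : Site (F.P K) 0 → Matrix.specialUnitaryGroup (Fin 2) ℂ |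
      ∀ U : GaugeField (F.P K) 0 (Matrix.specialUnitaryGroup (Fin 2) ℂ),
        descendTo F ℰp J K hJK (GaugeField.gaugeAct w U) = descendTo F ℰp J K hJK U} :=
  isCompact_iff_compactSpace.mp (isCompact_residualGauge F hJK)

end Topology

/-! ## §4 The invariant rows: fibres, UV-small histories, the action, print's regular fibre, the argmin set -/

section Invariants

variable (F : T3Family) {J K : ℕ} (hJK : J ≤ K)

/-- **RESIDUAL TRANSFORMATIONS PRESERVE EVERY FIBRE** `{U | D_{J,K}U = V}`. [cite: Balaban1985Variational, (4) p.278] -/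
theorem gaugeAct_mem_fibre_iff_of_residual {w : Site (F.P K) 0 → Matrix.specialUnitaryGroup (Fin 2) ℂ}
    (hw : ∀ U : GaugeField (F.P K) 0 (Matrix.specialUnitaryGroup (Fin 2) ℂ),
      descendTo F ℰp J K hJK (GaugeField.gaugeAct w U) = descendTo F ℰp J K hJK U)
    (U : GaugeField (F.P K) 0 (Matrix.specialUnitaryGroup (Fin 2) ℂ)) (V : GaugeField (F.P J) 0 (Matrix.specialUnitaryGroup (Fin 2) ℂ)) :
    GaugeField.gaugeAct w U ∈ fibre F ℰp J K hJK V ↔ U ∈ fibre F ℰp J K hJK V := by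
  show descendTo F ℰp J K hJK (GaugeField.gaugeAct w U) = V ↔ descendTo F ℰp J K hJK U = V
  rw [hw U]

/-- **EVERY GAUGE TRANSFORMATION PRESERVES THE UV-SMALL-HISTORY EVENTS** `histGood` (covariance of the iterated averages
`avg^j(U^w) = (avg^j U)^{w^{(j)}}` + conjugation invariance of `dist1`). [cite: Balaban1985UV3, (7) p.257; Balaban1985Averaging, (11) p.19] -/
theorem gaugeAct_mem_histGood_iff (w : Site (F.P K) 0 → Matrix.specialUnitaryGroup (Fin 2) ℂ) (θ : ℕ → ℝ) (n : ℕ)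
    (U : GaugeField (F.P K) 0 (Matrix.specialUnitaryGroup (Fin 2) ℂ)) :
    GaugeField.gaugeAct w U ∈ histGood F ℰp θ K n ↔ U ∈ histGood F ℰp θ K n := by
  unfold histGood
  simp only [Set.mem_setOf_eq]
  refine forall_congr' fun j => forall_congr' fun hj => ?_
  rw [iter_gaugeAct (fun i => BlockAveraging.blockAvg (P := F.P K) (j := i) ℰp) w j (by show j ≤ F.m + K; omega) U]
  exact plaqSmall_gaugeAct_iff' _ _ _

/-- **EVERY GAUGE TRANSFORMATION PRESERVES THE WILSON ACTION** (the tree's `wilsonAction_gaugeAct` at weight `1`).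
[cite: Balaban1985Variational, (1) p.278] -/
theorem wilsonAction4_gaugeAct (w : Site (F.P K) 0 → Matrix.specialUnitaryGroup (Fin 2) ℂ)
    (U : GaugeField (F.P K) 0 (Matrix.specialUnitaryGroup (Fin 2) ℂ)) :
    wilsonAction4 (GaugeField.gaugeAct w U) = wilsonAction4 U :=
  T4WilsonGaugeFlatDirection.wilsonAction_gaugeAct 1 w U

/-- **RESIDUAL TRANSFORMATIONS PRESERVE PRINT'S REGULAR FIBRE (6)** (`ε₀ ≥ 0`). [cite: Balaban1985Variational, (6) p.278] -/
theorem gaugeAct_mem_regFibrePr_iff_of_residual {ε₀ : ℝ} (hε : 0 ≤ ε₀) {w : Site (F.P K) 0 → Matrix.specialUnitaryGroup (Fin 2) ℂ}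
    (hw : ∀ U : GaugeField (F.P K) 0 (Matrix.specialUnitaryGroup (Fin 2) ℂ),
      descendTo F ℰp J K hJK (GaugeField.gaugeAct w U) = descendTo F ℰp J K hJK U)
    (U : GaugeField (F.P K) 0 (Matrix.specialUnitaryGroup (Fin 2) ℂ)) (V : GaugeField (F.P J) 0 (Matrix.specialUnitaryGroup (Fin 2) ℂ)) :
    GaugeField.gaugeAct w U ∈ regFibrePr F J K hJK ε₀ V ↔ U ∈ regFibrePr F J K hJK ε₀ V := by
  rw [mem_regFibrePr_iff, mem_regFibrePr_iff, gaugeAct_mem_fibre_iff_of_residual F hJK hw, regPr_gaugeAct_iff F hε]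

/-- **THE ARGMIN SET OVER A DATUM IS A UNION OF RESIDUAL ORBITS**: a residual `w` maps v6's `argminHist F γ b₀ p₀ ε₀ hJK V` (written
out) onto itself. [cite: Balaban1985Variational, Thm 1 (8) p.279] -/
theorem gaugeAct_mem_argmin_iff_of_residual {γ b₀ p₀ ε₀ : ℝ} {w : Site (F.P K) 0 → Matrix.specialUnitaryGroup (Fin 2) ℂ}
    (hw : ∀ U : GaugeField (F.P K) 0 (Matrix.specialUnitaryGroup (Fin 2) ℂ),
      descendTo F ℰp J K hJK (GaugeField.gaugeAct w U) = descendTo F ℰp J K hJK U)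
    (U : GaugeField (F.P K) 0 (Matrix.specialUnitaryGroup (Fin 2) ℂ)) (V : GaugeField (F.P J) 0 (Matrix.specialUnitaryGroup (Fin 2) ℂ)) :
    GaugeField.gaugeAct w U ∈
        {U' | U' ∈ fibre F ℰp J K hJK V ∧ U' ∈ histGood F ℰp (θBal F.L γ b₀ p₀) K J ∧
          wilsonAction4 U' = minActionRegPr F J K hJK ε₀ V} ↔
      U ∈ {U' | U' ∈ fibre F ℰp J K hJK V ∧ U' ∈ histGood F ℰp (θBal F.L γ b₀ p₀) K J ∧
          wilsonAction4 U' = minActionRegPr F J K hJK ε₀ V} := by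
  simp only [Set.mem_setOf_eq]
  rw [gaugeAct_mem_fibre_iff_of_residual F hJK hw, gaugeAct_mem_histGood_iff, wilsonAction4_gaugeAct]

end Invariants

end Summit.QuantumFields.YangMills.Theorems.FluctuationComparisonRegPrIntLS2BetaResidualGauge

end
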